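import Summits.ResolutionOfSingularities.ResolutionOfSingularities.Theorems.FrobeniusClosingPatchingRelPerfectDepthTargetsR5H
import Summits.ResolutionOfSingularities.ResolutionOfSingularities.Theorems.FrobeniusClosingPatchingRelPerfectDepthSepCJSPieceStep
import Summits.ResolutionOfSingularities.ResolutionOfSingularities.Theorems.FrobeniusClosingPatchingRelPerfectDepthSepPeelStep
import Summits.ResolutionOfSingularities.ResolutionOfSingularities.Theorems.FrobeniusClosingPatchingRelPerfectDepthSepFormatStepLemmas
import Summits.ResolutionOfSingularities.ResolutionOfSingularities.Theorems.FrobeniusClosingPatchingRelPerfectDepthWeightTwoBNrEndPackage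
import Summits.ResolutionOfSingularities.ResolutionOfSingularities.Theorems.FrobeniusClosingPatchingRelPerfectDepthOrderToolkit
import Literature.AlgebraicGeometry.Hironaka2017.Lib.MonomialPartBlowup
import HarnessLib

/-!
# Crux `PatchingRelPerfect` (stmt-ResolutionOfSingularities-16161), chain W5.2 — rung R5ᴴ, hand N3 «CJS transport on the carrier»:
# the TRANSPORT STATE, the KEY LAW (weight one = strict transform for snc members) and the SINGLE-PIECE STEP

[OURS · L1 W5.2 · R5ᴴ N3 (owner res-D-pv-055, targets `…DepthTargetsR5H` p535426; hand res-D-pv-054)] Fact-free; NOT statements of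
the manuscript under review (Hironaka 2017); AI-written, weaker than expert review.

The E-side game of R5ᴴ (`DepthTargets.HSepSeq`) blows up connected regular centres lying on a positively charged member and
transforms EVERY member by the weight-ONE controlled transform, appending the exceptional divisor with exponent `w − 1`.  N3
runs Cossart–Jannsen–Saito (F-32bR, `B = ∅`) on `X := Supp D ⊂ W` and transports it into `HSepSeq ρ [(D, ℓ)] 𝒟'` — the pattern
of res-D-pv-054's T6-E2 Phase A (`SepCJS.*`).  This module:
* §1 the state on the current scheme (exponent list `(D, ℓ) :: ℰ`, host member FIRST: `D` = the iterated weight-one controlled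
  transform of the initial divisor, an effective Cartier divisor; exceptional members `ℰ` snc; `W` regular) and the centre datum
  of one irreducible piece `Z` of a CJS centre (regular, INSIDE `Supp D`, snc with `ℰ`) — both carried as EXPLICIT HYPOTHESES
  (the module is definition-free);
* §2 LEGALITY `le_weightOf`: the host member lies over the piece and carries the exponent `ℓ`, so the weight is `≥ ℓ ≥ 1`;
* §3 the KEY LAW `controlledTransform_one_eq_strictTransformIdeal`: for a member `G` of a family snc with the regular irreducible
  centre `Z` (lying on a hypersurface), `τᶜ(G, 1)` IS the strict transform of `G` — res-D-pv-026's (L-A) at the generic order,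
  which is `1` when `Z ⊆ V(G)` (res-L1-w52's `SepStep.strictTransformIdeal_eq_controlledTransform_one`) and `0` otherwise
  (then both are `τ^*G`; cf. res-D-pv-055's `DepthTargets.controlledTransform_one_eq_comap_of_not_le`);
* §4 the SINGLE-PIECE STEP `piece_single`: blowing up one piece is ONE move `HSepSeq.cons`, the new exponent list being
  `(τᶜ(D,1), ℓ) :: WeightTwoB.stepExp ℰ τ 𝓘(Z) (w − 1)` by the KEY LAW (`map_controlledTransform_one_eq_stepExp`); the new state
  the host's new support squeezed between `τ⁻¹(Supp D ∖ Z)` and `τ⁻¹(Supp D)` (CJS's `X_{j+1} ⊆ Supp D_{j+1} ⊆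
  π⁻¹ Supp D₀`); the boundary bound and res-D-pv-054's cover `SepCJS.cover'`; `centre_transport` for a disjoint piece.

## References
* V. Cossart, U. Jannsen, S. Saito, LNM 2270 (2020), Thm. 1.4, (6.2), Def. 4.1, Thm. 6.9 (a). [CossartJannsenSaito2020]
* J. Kollár, *Lectures on Resolution of Singularities* (2007), Def. 3.25, 3.30.2, (3.111) Step 3. [Kollar2007]
* E. Bierstone, D. Grigoriev, P. Milman, J. Włodarczyk (2011), Def. 3.1.3, §3.2 Lemma 3.2.1, §4 Step 2b.
  [BierstoneGrigorievMilmanWlodarczyk2011]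
-/

-- `Summit.<Summit>.<Sub>.Theorems` with `Sub = Summit` (single-conjunct summit, D-0017)
set_option linter.dupNamespace false

noncomputable section

open CategoryTheory CategoryTheory.Limits AlgebraicGeometry TopologicalSpace IsLocalRing
open Literature.AlgebraicGeometry.Resolution Scheme.IdealSheafData
open Literature.AlgebraicGeometry.Hironaka2017.S16Proof
open Literature.AlgebraicGeometry.Hironaka2017.MonomialPart Literature.AlgebraicGeometry.Hironaka2017.MonomialComponent

namespace Summit.ResolutionOfSingularities.ResolutionOfSingularities.Theorems

universe u

namespace HSepCJS

open DepthSNC WeightTwoB DepthTargets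

variable {W : Scheme.{u}}

/-! ## §1 The state and the centre datum (def-free: carried as explicit hypotheses)

The TRANSPORT STATE on the current scheme `W` with exponent list `(D, ℓ) :: ℰ` is the triple of hypotheses
`Scheme.IsRegular W`, `IsEffectiveCartier D` (host member), `HasSNC (boundaryOf ℰ)` (exceptional members); the CENTRE DATUM of
one piece `Z` of a CJS centre is the quadruple `IsIrreducible Z`, `Scheme.IsRegular 𝓘(Z).subscheme`, `Z ⊆ Supp D`,
`HasSNCWith (boundaryOf ℰ) 𝓘(Z)`.  (No structure is declared, so that the module is definition-free.) -/

section Piece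

variable {D : W.IdealSheafData} {Z : Closeds W}

/-- The host member contains the piece: `D ≤ 𝓘(Z)`. [folklore] -/
theorem host_le_vanishingIdeal (hZD : (Z : Set W) ⊆ D.support) : D ≤ vanishingIdeal Z :=
  Scheme.IdealSheafData.le_support_iff_le_vanishingIdeal.mp hZD

/-- `D ≤ 𝓘(Z) ^ 1`. [folklore] -/
theorem host_le_vanishingIdeal_pow_one (hZD : (Z : Set W) ⊆ D.support) : D ≤ vanishingIdeal Z ^ 1 := by
  rw [pow_one]; exact host_le_vanishingIdeal hZD

/-- An irreducible piece is connected (as the support of `𝓘(Z)`). [folklore] -/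
theorem isPreconnected_support_vanishingIdeal (hirr : IsIrreducible (Z : Set W)) :
    _root_.IsPreconnected (((vanishingIdeal Z).support : Closeds W) : Set W) := by
  rw [Scheme.IdealSheafData.coe_support_vanishingIdeal]
  exact hirr.isPreirreducible.isPreconnected

end Piece

/-! ## §2 LEGALITY: the host member lies over every centre -/

/-- The host member is among the divisors over the centre piece. [folklore] -/
theorem host_mem_divisorsOver [IsLocallyNoetherian W] {D : W.IdealSheafData} (ℰ : List (W.IdealSheafData × ℕ)) {Z : Closeds W}
    (hZD : (Z : Set W) ⊆ D.support) (ℓ : ℕ) :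
    D ∈ divisorsOver ((D, ℓ) :: ℰ) (vanishingIdeal Z) (vanishingIdeal Z).support := by
  rw [mem_divisorsOver_iff]
  exact ⟨by simp [boundaryOf], fun x _ => stalkIdeal_mono (host_le_vanishingIdeal hZD) x⟩

/-- **LEGALITY of a CJS centre for `HSepSeq`**: the weight over the centre piece is at least the host exponent `ℓ`.
[cite: BierstoneGrigorievMilmanWlodarczyk2011, §3.2] -/
theorem le_weightOf [IsLocallyNoetherian W] {D : W.IdealSheafData} (ℰ : List (W.IdealSheafData × ℕ)) {Z : Closeds W}
    (hZD : (Z : Set W) ⊆ D.support) (ℓ : ℕ) :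
    ℓ ≤ weightOf ((D, ℓ) :: ℰ) (divisorsOver ((D, ℓ) :: ℰ) (vanishingIdeal Z) (vanishingIdeal Z).support) := by
  classical
  rw [weightOf_cons]
  simp only [host_mem_divisorsOver ℰ hZD ℓ, if_true]
  omega

/-! ## §3 The KEY LAW: the weight-ONE controlled transform of an snc member is its strict transform -/

section Law

variable [IsLocallyNoetherian W] [NoetherianSpace W]

/-- [OURS · L1 W5.2 · R5ᴴ N3] **KEY LAW.** `W` regular, `Z ⊂ W` an irreducible regular closed piece lying on an effective
Cartier divisor `H`, `𝓔` a family having simple normal crossings with `𝓘(Z)`, `G ∈ 𝓔` effective Cartier, `τ` the blowing up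
along `Z`.  Then the weight-one controlled transform `τᶜ(G, 1) = (τ^*G : 𝓘(E))` IS the strict transform of `G`.  If `Z ⊆ V(G)`
this is `G`'s generic order ONE along `Z` (an snc member has order one at each of its points; res-D-pv-026's (L-A) in
res-L1-w52's form `SepStep.strictTransformIdeal_eq_controlledTransform_one`); if `Z ⊄ V(G)` the generic order is ZERO, the strict
transform is the total transform ((L-A) with `m = 0`), and `τ^*G ≤ τᶜ(G,1) ≤ strict` sandwiches (the half `τᶜ(G, 1) = τ^*G` is
res-D-pv-055's `DepthTargets.controlledTransform_one_eq_comap_of_not_le`, `…DepthHSepOffCentre`).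
[cite: Kollar2007, 3.30.2] [cite: BierstoneGrigorievMilmanWlodarczyk2011, §3.2 Lemma 3.2.1] -/
theorem controlledTransform_one_eq_strictTransformIdeal (hW : Scheme.IsRegular W) {Z : Closeds W}
    (hirr : IsIrreducible (Z : Set W)) (hZ : Scheme.IsRegular (vanishingIdeal Z).subscheme)
    {H : W.IdealSheafData} (hH : IsEffectiveCartier H) (hHZ : (Z : Set W) ⊆ H.support)
    {𝓔 : List W.IdealSheafData} (hsnc : HasSNCWith 𝓔 (vanishingIdeal Z)) {G : W.IdealSheafData} (hG : G ∈ 𝓔)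
    (hGc : IsEffectiveCartier G) {W' : Scheme.{u}} {τ : W' ⟶ W} (hτ : IsBlowup τ (vanishingIdeal Z)) :
    controlledTransform τ (vanishingIdeal Z) G 1 = strictTransformIdeal τ (vanishingIdeal Z) G := by
  haveI : IsLocallyNoetherian W' := hτ.isLocallyNoetherian
  obtain ⟨η, hη⟩ : ∃ η : W, IsGenericPoint η (Z : Set W) := QuasiSober.sober hirr Z.isClosed
  have hZsupp : (((vanishingIdeal Z).support : Closeds W) : Set W) = Z := Scheme.IdealSheafData.coe_support_vanishingIdeal Z
  have hη' : IsGenericPoint η (((vanishingIdeal Z).support : Closeds W) : Set W) := by rwa [hZsupp]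
  have hconn : _root_.IsPreconnected (((vanishingIdeal Z).support : Closeds W) : Set W) := by
    rw [hZsupp]; exact hirr.isPreirreducible.isPreconnected
  have hHle : H ≤ vanishingIdeal Z := Scheme.IdealSheafData.le_support_iff_le_vanishingIdeal.mp hHZ
  by_cases hle : G ≤ vanishingIdeal Z
  · -- `Z ⊆ V(G)`: generic order one
    refine (DepthGraded.SepStep.strictTransformIdeal_eq_controlledTransform_one hW hZ hconn hH hHle hGc hle hτ
      fun y hy => ?_).symm
    exact Nr.not_stalkIdeal_le_sq_of_sncWithAt ((DepthSNC.hasSNCWith_iff_sncWithAt _ _).mp hsnc y) hG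
      (support_antitone hle hy)
  · -- `Z ⊄ V(G)`: generic order zero, strict = total transform, sandwich
    have hηG : η ∉ G.support := fun h => hle (le_vanishingIdeal_of_isGenericPoint_mem hη h)
    have hm : idealOrder G η = 0 := (DepthTargets.idealOrder_eq_zero_iff_not_mem_support G η).mpr hηG
    have hint : interior (((vanishingIdeal Z).support : Closeds W) : Set W) = ∅ :=
      interior_eq_empty_of_isGenericPoint_of_mem_support hη' hH (hHZ hη.mem)
    have hB : strictTransformIdeal τ (vanishingIdeal Z) G = G.comap τ := by
      rw [hτ.strictTransformIdeal_eq_controlledTransform hW hZ hη' hint hm hGc, controlledTransform_zero]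
    refine le_antisymm (controlledTransform_le_strictTransformIdeal τ (vanishingIdeal Z) G 1) ?_
    rw [hB]
    exact comap_le_controlledTransform τ (vanishingIdeal Z) G 1

end Law

/-! ## §4 The single-piece step -/

section Step

variable [IsLocallyNoetherian W] {D : W.IdealSheafData} {ℰ : List (W.IdealSheafData × ℕ)} {Z : Closeds W}
  {W' : Scheme.{u}} {τ : W' ⟶ W}

/-! ### The list identity (KEY LAW member by member) -/

/-- **The weight-one law of `HSepSeq` on the exceptional members is the strict transform**: the transported list is
`stepExp ℰ τ 𝓘(Z) e`. [cite: Kollar2007, 3.30.2] -/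
theorem map_controlledTransform_one_eq_stepExp [NoetherianSpace W] (hW : Scheme.IsRegular W) (hD : IsEffectiveCartier D)
    (hirr : IsIrreducible (Z : Set W)) (hZ : Scheme.IsRegular (vanishingIdeal Z).subscheme) (hZD : (Z : Set W) ⊆ D.support)
    (hsnc : HasSNCWith (boundaryOf ℰ) (vanishingIdeal Z)) (hτ : IsBlowup τ (vanishingIdeal Z)) (e : ℕ) :
    ℰ.map (fun p => (controlledTransform τ (vanishingIdeal Z) p.1 1, p.2)) ++ [((vanishingIdeal Z).comap τ, e)] =
      stepExp ℰ τ (vanishingIdeal Z) e := by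
  unfold stepExp
  congr 1
  refine List.map_congr_left fun p hp => ?_
  have hmem : p.1 ∈ boundaryOf ℰ := mem_boundaryOf_iff.mpr ⟨p.2, hp⟩
  rw [controlledTransform_one_eq_strictTransformIdeal hW hirr hZ hD hZD hsnc hmem (hsnc.isEffectiveCartier_of_mem hmem) hτ]

/-! ### The new state -/

/-- The blown-up scheme is regular. [cite: Kollar2007, 3.30.2] -/
theorem isRegular' (hW : Scheme.IsRegular W) (hZ : Scheme.IsRegular (vanishingIdeal Z).subscheme)
    (hτ : IsBlowup τ (vanishingIdeal Z)) : Scheme.IsRegular W' :=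
  hτ.isRegular_of_isRegular_subscheme hW hZ

omit [IsLocallyNoetherian W] in
/-- The transported host member is an effective Cartier divisor (`D ≤ 𝓘(Z)¹`). [cite: BierstoneGrigorievMilmanWlodarczyk2011, §3.2] -/
theorem hostCartier' (hD : IsEffectiveCartier D) (hZD : (Z : Set W) ⊆ D.support) (hτ : IsBlowup τ (vanishingIdeal Z)) :
    IsEffectiveCartier (controlledTransform τ (vanishingIdeal Z) D 1) :=
  hτ.isEffectiveCartier_controlledTransform_of_le_pow hD (host_le_vanishingIdeal_pow_one hZD)

/-- The new exceptional members have simple normal crossings. [cite: Kollar2007, Def. 3.25] -/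
theorem sncE' (hsnc : HasSNCWith (boundaryOf ℰ) (vanishingIdeal Z)) (hτ : IsBlowup τ (vanishingIdeal Z)) (e : ℕ) :
    HasSNC (boundaryOf (stepExp ℰ τ (vanishingIdeal Z) e)) := by
  rw [boundaryOf_stepExp]; exact hsnc.hasSNC_transform hτ

/-! ### The host member's new support -/

omit [IsLocallyNoetherian W] in
/-- **Lower bound**: `τ⁻¹(Supp D ∖ Z) ⊆ Supp τᶜ(D, 1)` (off the exceptional divisor the controlled transform is the total
transform). [cite: BierstoneGrigorievMilmanWlodarczyk2011, §3.2] -/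
theorem preimage_diff_subset_support_host' (hτ : IsBlowup τ (vanishingIdeal Z)) :
    τ ⁻¹' ((D.support : Set W) \ (Z : Set W)) ⊆ ((controlledTransform τ (vanishingIdeal Z) D 1).support : Set W') := by
  intro x' hx'
  refine hτ.closure_preimage_diff_subset_support_controlledTransform 1 (subset_closure ?_)
  rw [Scheme.IdealSheafData.coe_support_vanishingIdeal]
  exact hx'

omit [IsLocallyNoetherian W] in
/-- **Upper bound**: `Supp τᶜ(D, 1) ⊆ τ⁻¹(Supp D)`. [folklore] -/
theorem support_host'_subset :
    ((controlledTransform τ (vanishingIdeal Z) D 1).support : Set W') ⊆ τ ⁻¹' (D.support : Set W) := by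
  intro x' hx'
  have h : x' ∈ ((D.comap τ).support : Set W') :=
    support_antitone (comap_le_controlledTransform τ (vanishingIdeal Z) D 1) hx'
  exact (mem_support_comap_iff τ D x').mp h

omit [IsLocallyNoetherian W] in
/-- **The boundary bound**: every new exceptional member lies over `B₀ ⊇ ⋃ Supp ℰ ∪ Z`. [cite: CossartJannsenSaito2020, (6.2)] -/
theorem bd' {B₀ : Set W} (hℰB : ∀ p ∈ ℰ, (p.1.support : Set W) ⊆ B₀) (hZB : (Z : Set W) ⊆ B₀) (e : ℕ) :
    ∀ p ∈ stepExp ℰ τ (vanishingIdeal Z) e, (p.1.support : Set W') ⊆ τ ⁻¹' B₀ := by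
  intro p hp
  rcases mem_stepExp_iff.mp hp with ⟨q, hq, rfl⟩ | rfl
  · intro x' hx'
    exact hℰB q hq (mem_support_of_mem_support_strictTransformIdeal hx')
  · intro x' hx'
    rw [Scheme.IdealSheafData.support_comap, Closeds.coe_preimage, Scheme.IdealSheafData.coe_support_vanishingIdeal] at hx'
    exact hZB hx'

/-! ### Transport of the centre data of a disjoint piece -/

/-- **The centre data of a DISJOINT piece survive the blow-up** (on `τ⁻¹Z₂`, for the transported state): irreducible, regular,
inside the new host's support, snc with the new exceptional members.
[cite: Kollar2007, Def. 3.25] [cite: BierstoneGrigorievMilmanWlodarczyk2011, §3.2] -/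
theorem centre_transport (hsnc : HasSNCWith (boundaryOf ℰ) (vanishingIdeal Z)) (hτ : IsBlowup τ (vanishingIdeal Z))
    {Z₂ : Closeds W} (hirr₂ : IsIrreducible (Z₂ : Set W)) (hZ₂ : Scheme.IsRegular (vanishingIdeal Z₂).subscheme)
    (hZ₂D : (Z₂ : Set W) ⊆ D.support) (hsnc₂ : HasSNCWith (boundaryOf ℰ) (vanishingIdeal Z₂))
    (hd : Disjoint (Z : Set W) Z₂) (e : ℕ) :
    IsIrreducible ((Z₂.preimage τ.continuous : Closeds W') : Set W') ∧
      Scheme.IsRegular (vanishingIdeal (Z₂.preimage τ.continuous : Closeds W')).subscheme ∧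
      ((Z₂.preimage τ.continuous : Closeds W') : Set W') ⊆ (controlledTransform τ (vanishingIdeal Z) D 1).support ∧
      HasSNCWith (boundaryOf (stepExp ℰ τ (vanishingIdeal Z) e)) (vanishingIdeal (Z₂.preimage τ.continuous)) := by
  haveI : IsLocallyNoetherian W' := hτ.isLocallyNoetherian
  have hd' : Disjoint (Z₂ : Set W) ((vanishingIdeal Z).support : Set W) := by
    rw [Scheme.IdealSheafData.coe_support_vanishingIdeal]; exact hd.symm
  have hdC : Disjoint ((vanishingIdeal Z).support : Set W) ((vanishingIdeal Z₂).support : Set W) := by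
    rw [Scheme.IdealSheafData.coe_support_vanishingIdeal, Scheme.IdealSheafData.coe_support_vanishingIdeal]; exact hd
  have hcomap : (vanishingIdeal Z₂).comap τ = vanishingIdeal (Z₂.preimage τ.continuous) :=
    hτ.comap_vanishingIdeal_of_disjoint Z₂ hd'
  refine ⟨hτ.isIrreducible_preimage_of_disjoint Z₂ hd' hirr₂, hτ.isRegular_subscheme_vanishingIdeal_preimage Z₂ hd' hZ₂,
    fun y' hy' => ?_, ?_⟩
  · have hy : τ y' ∈ (Z₂ : Set W) := hy'
    exact preimage_diff_subset_support_host' hτ ⟨hZ₂D hy, Set.disjoint_right.mp hd hy⟩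
  · have h := HasSNCWith.transform_comap_of_disjoint hτ hsnc hsnc₂ hdC
    rwa [← boundaryOf_stepExp ℰ τ (vanishingIdeal Z) e, hcomap] at h

end Step

/-! ### The single-piece step, packaged -/

/-- **The single-piece step**: blowing up ONE piece `Z` of the current state extends the separation sequence by one
`HSepSeq.cons` (the centre is regular, connected, of weight `≥ ℓ ≥ 1`), the new list being `(τᶜ(D,1), ℓ) :: stepExp ℰ τ 𝓘(Z) (w − 1)`
by the KEY LAW; with the new state (regular, host effective Cartier, exceptional members snc), the two bounds on the host's
support, the boundary bound and the boundary cover (res-D-pv-054's `SepCJS.cover'`).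
[cite: CossartJannsenSaito2020, (6.2), Def. 4.1] [cite: Kollar2007, 3.30.2] [cite: BierstoneGrigorievMilmanWlodarczyk2011, §4 Step 2b] -/
theorem piece_single
    {W₀ W : Scheme.{u}} [IsIntegral W] [IsNoetherian W] {ρ : W ⟶ W₀} {𝒟₀ : List (W₀.IdealSheafData × ℕ)}
    {D : W.IdealSheafData} {ℓ : ℕ} {ℰ : List (W.IdealSheafData × ℕ)} (hW : Scheme.IsRegular W) (hD : IsEffectiveCartier D)
    (hℓ : 1 ≤ ℓ) (hseq : HSepSeq ρ 𝒟₀ ((D, ℓ) :: ℰ)) {Z : Closeds W} (hirr : IsIrreducible (Z : Set W))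
    (hZ : Scheme.IsRegular (vanishingIdeal Z).subscheme) (hZD : (Z : Set W) ⊆ D.support)
    (hsnc : HasSNCWith (boundaryOf ℰ) (vanishingIdeal Z))
    {B₀ : Set W} (hℰB : ∀ p ∈ ℰ, (p.1.support : Set W) ⊆ B₀) (hZB : (Z : Set W) ⊆ B₀)
    {W' : Scheme.{u}} {τ : W' ⟶ W} (hτ : IsBlowup τ (vanishingIdeal Z)) :
    ∃ (_ : IsIntegral W') (_ : IsNoetherian W') (e : ℕ),
      HSepSeq (τ ≫ ρ) 𝒟₀ ((controlledTransform τ (vanishingIdeal Z) D 1, ℓ) :: stepExp ℰ τ (vanishingIdeal Z) e) ∧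
        Scheme.IsRegular W' ∧ IsEffectiveCartier (controlledTransform τ (vanishingIdeal Z) D 1) ∧
        HasSNC (boundaryOf (stepExp ℰ τ (vanishingIdeal Z) e)) ∧
        τ ⁻¹' ((D.support : Set W) \ (Z : Set W)) ⊆ ((controlledTransform τ (vanishingIdeal Z) D 1).support : Set W') ∧
        ((controlledTransform τ (vanishingIdeal Z) D 1).support : Set W') ⊆ τ ⁻¹' (D.support : Set W) ∧
        (∀ p ∈ stepExp ℰ τ (vanishingIdeal Z) e, (p.1.support : Set W') ⊆ τ ⁻¹' B₀) ∧
        (∀ x' : W', ((∃ p ∈ ℰ, τ x' ∈ p.1.support) ∨ τ x' ∈ (Z : Set W)) →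
          ∃ p ∈ stepExp ℰ τ (vanishingIdeal Z) e, x' ∈ p.1.support) := by
  -- the centre is not the zero ideal: `Z ⊆ Supp D`, a proper closed subset
  have hCne : vanishingIdeal Z ≠ ⊥ := by
    intro h0
    have hZu : (Z : Set W) = Set.univ := by
      rw [← Scheme.IdealSheafData.coe_support_vanishingIdeal Z, h0, Scheme.IdealSheafData.support_bot]; rfl
    have hdense := hD.dense_compl_support
    have hempty : ((D.support : Set W)ᶜ) = ∅ := by
      rw [Set.compl_empty_iff, Set.eq_univ_iff_forall]
      intro x
      exact hZD (by rw [hZu]; trivial)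
    have := hdense.nonempty
    rw [hempty] at this
    exact Set.not_nonempty_empty this
  haveI hint' : IsIntegral W' := hτ.isIntegral hCne
  haveI hnoeth' : IsNoetherian W' := isNoetherian_of_isBlowup hτ
  set w := weightOf ((D, ℓ) :: ℰ) (divisorsOver ((D, ℓ) :: ℰ) (vanishingIdeal Z) (vanishingIdeal Z).support) with hw
  have hcons := HSepSeq.cons τ ρ 𝒟₀ ((D, ℓ) :: ℰ) (vanishingIdeal Z) hseq hZ (isPreconnected_support_vanishingIdeal hirr)
    (hℓ.trans (le_weightOf ℰ hZD ℓ)) hτ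
  rw [← hw] at hcons
  simp only [List.map_cons, List.cons_append] at hcons
  rw [map_controlledTransform_one_eq_stepExp hW hD hirr hZ hZD hsnc hτ] at hcons
  exact ⟨hint', hnoeth', w - 1, hcons, isRegular' hW hZ hτ, hostCartier' hD hZD hτ, sncE' hsnc hτ _,
    preimage_diff_subset_support_host' hτ, support_host'_subset, bd' hℰB hZB _, fun x' hx => SepCJS.cover' hτ _ hx⟩

end HSepCJS

end Summit.ResolutionOfSingularities.ResolutionOfSingularities.Theorems

end
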